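/-
Copyright (c) 2026 the pub-hodgecm-mathlib formalisation cell (harness21).  Prover seat hodgecm-mathlib-F0P3a-p01 (g36), FLOOR 0, SUPPORTS-ONLY on h413; dealer LH4-plan (g13)
WORD #74 (1): owner of (T-box | lev) (b)+(c).  FILE 2a «LEV ARITH».  2026-09-04.
-/
import Mathlib.Tactic.Ring
import Mathlib.Tactic.Linarith
import HarnessLib

/-!
# Crux `H413`, LH4 «(D-RAM) FOUR-FRAME» road, STAGE 1b — brick (T-box | lev) FILE 2a «LEV ARITH»: the pure-`ℕ` exponent identities of the general two-parameter law (L-gen)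

Cell `hodgecm-mathlib` (D-0151), crux item H413 = `stmt-HodgeConjecture-24833`, route of record `HCCMUnconditional`.  THEOREMS ONLY (linear arithmetic over `ℕ`, each closed by
`omega` on a context free of `min`∕`max`∕`∕`; no `def`, no instance, no notation, no `sorry`, default heartbeats); lane `--supports stmt-HodgeConjecture-24833 --as helper`.

THE LETTERS (memo `F0/P3a/F0P3a-p01/g36/tbox/TBOX-LEV-SPEC.v1.F0P3ap01g36.md` 7f362386 §4; statements certified numerically by `tbox/arith_probe.py`, 42 120 own-slot cases +
cross∕equilateral, 0 violations).  An isoceles key with glue depth `m = 2a + δ` and apex `m + 2t` (`d = 2e + δ`), levels `ℓ₁ ≤ 2`, `ℓ₂ ≤ m + ℓ₁`: write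
`m − ℓ₁ = 2M + μ`, `⌊(2m − ℓ₂)∕2⌋ = M + cW`, `⌊(2m − d + 1 − ℓ₁)∕2⌋ = M + cV`, `⌊(ℓ₂+1)∕2⌋ = Gh`, `⌊(ℓ₁+1−δ)∕2⌋ = Yh` (= y∕2) — fed to `omega` through the
DERIVED LINEAR LETTERS `2M + μ + ℓ₁ = m`, `cW + Gh = M + μ + ℓ₁`, `cV + e = a + μ`, `2Yh + δ = ℓ₁ + μ` (FILE 2b derives them from the floors) — the locus window top `C = min(M+μ, cW, cV)`,
the law top letter `X = max(ℓ₁, (Gh − e)⁺ + Yh)`, the box height `B = (a + t + 1 − 3e)⁺` (own slot) ∕ `(a + 1 − 3e)⁺` (cross), `P = max(X, B + y)`, `k = 3a + t + δ + 1 − e`.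
Every `min`∕`max` is LINEARISED into a disjunction BEFORE `omega` (FILE 2b's `min3_linear`∕`max_linear`), which keeps each call small.
* `lev_arith_top` (window top = `k − X` when `1 ≤ C`), `lev_arith_deep_bot`, `lev_arith_deep_top`, `lev_arith_shallow_bot`, `lev_arith_shallow_empty` (own slot),
  `lev_arith_cross_bot`, `lev_arith_cross_empty` (cross slots, and the equilateral `H` window at `t = 0`).

HONEST LABEL: arithmetic helper toward `levLabelledBoxSumWide_holds`; pays no tier-0 row; HC_CM is proved only modulo the 7 printed citations (2 remaining named inputs:
hLiu418 = `stmt-HodgeConjecture-24832`, h413 = `stmt-HodgeConjecture-24833`) until rung 0 closes.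

## References
* [Kottwitz1986BaseChangeUnits] R. E. Kottwitz, *Base change for unit elements of Hecke algebras*, Compositio Math. 60 (1986), §1 pp. 240–241.
* [Rogawski1990] J. D. Rogawski, *Automorphic Representations of Unitary Groups in Three Variables*, Ann. of Math. Stud. 123 (1990), §4.9 Prop. 4.9.1 (a) p. 55.
-/

set_option autoImplicit false

namespace Summit.HodgeConjecture.HodgeConjecture.Cruxes.H413.F0P3cDyRamLevBoxSumArith

/-- (L-gen) exponent bookkeeping: the window top is the law top `k − X` whenever the locus window is nonempty. [folklore] -/
theorem lev_arith_top (a t e δ ℓ₁ k M μ cW cV Gh Yh : ℕ)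
    (hδ : δ ≤ 1) (hd : 2 ≤ 2 * e + δ) (hℓ₁ : ℓ₁ ≤ 2)
    (hμ : μ ≤ 1) (hM : 2 * M + μ + ℓ₁ = 2 * a + δ) (hcW : cW + Gh = M + μ + ℓ₁) (hcV : cV + e = a + μ)
    (hYh : 2 * Yh + δ = ℓ₁ + μ) (hk' : k + e = 3 * a + t + δ + 1)
    (C : ℕ) (hC3 : (C = M + μ ∧ M + μ ≤ cW ∧ M + μ ≤ cV) ∨ (C = cW ∧ cW ≤ M + μ ∧ cW ≤ cV) ∨ (C = cV ∧ cV ≤ M + μ ∧ cV ≤ cW))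
    (x₂ : ℕ) (hx₂ : (e ≤ Gh ∧ Gh = e + x₂) ∨ (Gh < e ∧ x₂ = 0)) (X : ℕ) (hX2 : (X = ℓ₁ ∧ x₂ + Yh ≤ ℓ₁) ∨ (X = x₂ + Yh ∧ ℓ₁ ≤ x₂ + Yh))
    : 2 * M + t + C + 1 + X = k := by
  rcases hC3 with hC | hC | hC <;> omega

/-- (L-gen) exponent bookkeeping: own slot, deep apex: the tube bottom is the law bottom `k − max(X, B + y)`. [folklore] -/
theorem lev_arith_deep_bot (a t e δ ℓ₁ k M μ cW cV Gh Yh : ℕ)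
    (hδ : δ ≤ 1) (hℓ₁ : ℓ₁ ≤ 2)
    (hμ : μ ≤ 1) (hM : 2 * M + μ + ℓ₁ = 2 * a + δ) (hcW : cW + Gh = M + μ + ℓ₁) (hcV : cV + e = a + μ)
    (hYh : 2 * Yh + δ = ℓ₁ + μ) (hk' : k + e = 3 * a + t + δ + 1)
    (x₂ : ℕ) (hx₂ : (e ≤ Gh ∧ Gh = e + x₂) ∨ (Gh < e ∧ x₂ = 0)) (X : ℕ) (hX2 : (X = ℓ₁ ∧ x₂ + Yh ≤ ℓ₁) ∨ (X = x₂ + Yh ∧ ℓ₁ ≤ x₂ + Yh))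
    (Bq : ℕ) (hB : (3 * e ≤ a + t + 1 ∧ Bq + 3 * e = a + t + 1) ∨ (a + t + 1 < 3 * e ∧ Bq = 0))
    (P : ℕ) (hP2 : (P = X ∧ Bq + 2 * Yh ≤ X) ∨ (P = Bq + 2 * Yh ∧ X ≤ Bq + 2 * Yh))
    (hdeep : 2 * a + δ + 2 * (2 * e + δ) ≤ 2 * (a + t) + δ)
    : 2 * M + (2 * e + δ) + P = k := by
  omega

/-- (L-gen) exponent bookkeeping: own slot, deep apex, empty window: the tube top is the law top. [folklore] -/
theorem lev_arith_deep_top (a t e δ ℓ₁ k M μ cW cV Gh Yh : ℕ)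
    (hδ : δ ≤ 1) (hd : 2 ≤ 2 * e + δ) (hℓ₁ : ℓ₁ ≤ 2)
    (hfg : 2 * (2 * e + δ) ≤ 2 * a + δ + 1)
    (hμ : μ ≤ 1) (hM : 2 * M + μ + ℓ₁ = 2 * a + δ) (hcW : cW + Gh = M + μ + ℓ₁) (hcV : cV + e = a + μ)
    (hYh : 2 * Yh + δ = ℓ₁ + μ) (hk' : k + e = 3 * a + t + δ + 1)
    (C : ℕ) (hC3 : (C = M + μ ∧ M + μ ≤ cW ∧ M + μ ≤ cV) ∨ (C = cW ∧ cW ≤ M + μ ∧ cW ≤ cV) ∨ (C = cV ∧ cV ≤ M + μ ∧ cV ≤ cW))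
    (x₂ : ℕ) (hx₂ : (e ≤ Gh ∧ Gh = e + x₂) ∨ (Gh < e ∧ x₂ = 0)) (X : ℕ) (hX2 : (X = ℓ₁ ∧ x₂ + Yh ≤ ℓ₁) ∨ (X = x₂ + Yh ∧ ℓ₁ ≤ x₂ + Yh))

    (hwin : ¬ 1 ≤ C) : M + t + M + 1 + X = k := by
  rcases hC3 with hC | hC | hC <;> omega

/-- (L-gen) exponent bookkeeping: own slot, shallow apex: the window bottom is the law bottom. [folklore] -/
theorem lev_arith_shallow_bot (a t e δ ℓ₁ k M μ cW cV Gh Yh : ℕ)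
    (hδ : δ ≤ 1) (hℓ₁ : ℓ₁ ≤ 2)
    (hμ : μ ≤ 1) (hM : 2 * M + μ + ℓ₁ = 2 * a + δ) (hcW : cW + Gh = M + μ + ℓ₁) (hcV : cV + e = a + μ)
    (hYh : 2 * Yh + δ = ℓ₁ + μ) (hk' : k + e = 3 * a + t + δ + 1)
    (C : ℕ) (hC3 : (C = M + μ ∧ M + μ ≤ cW ∧ M + μ ≤ cV) ∨ (C = cW ∧ cW ≤ M + μ ∧ cW ≤ cV) ∨ (C = cV ∧ cV ≤ M + μ ∧ cV ≤ cW))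
    (x₂ : ℕ) (hx₂ : (e ≤ Gh ∧ Gh = e + x₂) ∨ (Gh < e ∧ x₂ = 0)) (X : ℕ) (hX2 : (X = ℓ₁ ∧ x₂ + Yh ≤ ℓ₁) ∨ (X = x₂ + Yh ∧ ℓ₁ ≤ x₂ + Yh))
    (Bq : ℕ) (hB : (3 * e ≤ a + t + 1 ∧ Bq + 3 * e = a + t + 1) ∨ (a + t + 1 < 3 * e ∧ Bq = 0))
    (P : ℕ) (hP2 : (P = X ∧ Bq + 2 * Yh ≤ X) ∨ (P = Bq + 2 * Yh ∧ X ≤ Bq + 2 * Yh))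
    (Lq : ℕ) (hL : 2 * e + δ = t + Lq)
    (hwin : Lq ≤ C) : 2 * M + (2 * e + δ) + P = k := by
  rcases hC3 with hC | hC | hC <;> omega

/-- (L-gen) exponent bookkeeping: own slot, shallow apex, empty window: the law is empty. [folklore] -/
theorem lev_arith_shallow_empty (a t e δ ℓ₁ ℓ₂ k M μ cW cV Gh γ Yh : ℕ)
    (hδ : δ ≤ 1) (hℓ₁ : ℓ₁ ≤ 2)
    (hcorner : (2 * e + δ) % 2 = 0 → ℓ₁ = 1 → 2 * e + δ + 1 ≤ ℓ₂) (hfg : 2 * (2 * e + δ) ≤ 2 * a + δ + 1)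
    (hμ : μ ≤ 1) (hM : 2 * M + μ + ℓ₁ = 2 * a + δ) (hcW : cW + Gh = M + μ + ℓ₁) (hcV : cV + e = a + μ)
    (hγ : γ ≤ 1) (hGh : ℓ₂ + 1 = 2 * Gh + γ) (hYh : 2 * Yh + δ = ℓ₁ + μ) (hk' : k + e = 3 * a + t + δ + 1)
    (C : ℕ) (hC3 : (C = M + μ ∧ M + μ ≤ cW ∧ M + μ ≤ cV) ∨ (C = cW ∧ cW ≤ M + μ ∧ cW ≤ cV) ∨ (C = cV ∧ cV ≤ M + μ ∧ cV ≤ cW))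
    (x₂ : ℕ) (hx₂ : (e ≤ Gh ∧ Gh = e + x₂) ∨ (Gh < e ∧ x₂ = 0)) (X : ℕ) (hX2 : (X = ℓ₁ ∧ x₂ + Yh ≤ ℓ₁) ∨ (X = x₂ + Yh ∧ ℓ₁ ≤ x₂ + Yh))
    (Bq : ℕ) (hB : (3 * e ≤ a + t + 1 ∧ Bq + 3 * e = a + t + 1) ∨ (a + t + 1 < 3 * e ∧ Bq = 0))
    (P : ℕ) (hP2 : (P = X ∧ Bq + 2 * Yh ≤ X) ∨ (P = Bq + 2 * Yh ∧ X ≤ Bq + 2 * Yh))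
    (ht : 1 ≤ t) (Lq : ℕ) (hL : 2 * e + δ = t + Lq)
    (hwin : ¬ Lq ≤ C) : P = X := by
  rcases hC3 with hC | hC | hC <;> omega

/-- (L-gen) exponent bookkeeping: cross slot (and the equilateral `H` window at `t = 0`): the window bottom is the law bottom. [folklore] -/
theorem lev_arith_cross_bot (a t e δ ℓ₁ k M μ cW cV Gh Yh : ℕ)
    (hδ : δ ≤ 1) (hd : 2 ≤ 2 * e + δ) (hℓ₁ : ℓ₁ ≤ 2)
    (hfg : 2 * (2 * e + δ) ≤ 2 * a + δ + 1)
    (hμ : μ ≤ 1) (hM : 2 * M + μ + ℓ₁ = 2 * a + δ) (hcW : cW + Gh = M + μ + ℓ₁) (hcV : cV + e = a + μ)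
    (hYh : 2 * Yh + δ = ℓ₁ + μ) (hk' : k + e = 3 * a + t + δ + 1)
    (C : ℕ) (hC3 : (C = M + μ ∧ M + μ ≤ cW ∧ M + μ ≤ cV) ∨ (C = cW ∧ cW ≤ M + μ ∧ cW ≤ cV) ∨ (C = cV ∧ cV ≤ M + μ ∧ cV ≤ cW))
    (x₂ : ℕ) (hx₂ : (e ≤ Gh ∧ Gh = e + x₂) ∨ (Gh < e ∧ x₂ = 0)) (X : ℕ) (hX2 : (X = ℓ₁ ∧ x₂ + Yh ≤ ℓ₁) ∨ (X = x₂ + Yh ∧ ℓ₁ ≤ x₂ + Yh))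
    (Bq : ℕ) (hB : (3 * e ≤ a + 1 ∧ Bq + 3 * e = a + 1) ∨ (a + 1 < 3 * e ∧ Bq = 0))
    (P : ℕ) (hP2 : (P = X ∧ Bq + 2 * Yh ≤ X) ∨ (P = Bq + 2 * Yh ∧ X ≤ Bq + 2 * Yh))
    (hwin : 2 * e + δ ≤ C) : 2 * M + t + (2 * e + δ) + P = k := by
  rcases hC3 with hC | hC | hC <;> omega

/-- (L-gen) exponent bookkeeping: cross slot (and `H` at `t = 0`), empty window: the law is empty. [folklore] -/
theorem lev_arith_cross_empty (a t e δ ℓ₁ ℓ₂ k M μ cW cV Gh γ Yh : ℕ)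
    (hδ : δ ≤ 1) (hd : 2 ≤ 2 * e + δ) (hℓ₁ : ℓ₁ ≤ 2)
    (hcorner : (2 * e + δ) % 2 = 0 → ℓ₁ = 1 → 2 * e + δ + 1 ≤ ℓ₂) (hfg : 2 * (2 * e + δ) ≤ 2 * a + δ + 1)
    (hμ : μ ≤ 1) (hM : 2 * M + μ + ℓ₁ = 2 * a + δ) (hcW : cW + Gh = M + μ + ℓ₁) (hcV : cV + e = a + μ)
    (hγ : γ ≤ 1) (hGh : ℓ₂ + 1 = 2 * Gh + γ) (hYh : 2 * Yh + δ = ℓ₁ + μ) (hk' : k + e = 3 * a + t + δ + 1)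
    (C : ℕ) (hC3 : (C = M + μ ∧ M + μ ≤ cW ∧ M + μ ≤ cV) ∨ (C = cW ∧ cW ≤ M + μ ∧ cW ≤ cV) ∨ (C = cV ∧ cV ≤ M + μ ∧ cV ≤ cW))
    (x₂ : ℕ) (hx₂ : (e ≤ Gh ∧ Gh = e + x₂) ∨ (Gh < e ∧ x₂ = 0)) (X : ℕ) (hX2 : (X = ℓ₁ ∧ x₂ + Yh ≤ ℓ₁) ∨ (X = x₂ + Yh ∧ ℓ₁ ≤ x₂ + Yh))
    (Bq : ℕ) (hB : (3 * e ≤ a + 1 ∧ Bq + 3 * e = a + 1) ∨ (a + 1 < 3 * e ∧ Bq = 0))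
    (P : ℕ) (hP2 : (P = X ∧ Bq + 2 * Yh ≤ X) ∨ (P = Bq + 2 * Yh ∧ X ≤ Bq + 2 * Yh))
    (hwin : ¬ 2 * e + δ ≤ C) : P = X := by
  rcases hC3 with hC | hC | hC <;> omega

end Summit.HodgeConjecture.HodgeConjecture.Cruxes.H413.F0P3cDyRamLevBoxSumArith
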